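import Summits.HubbardSuperconductivity.HubbardSuperconductivity.Theorems.AnisotropyChordTransferFibre3TwoHoleBSTail
import Summits.HubbardSuperconductivity.HubbardSuperconductivity.Theorems.AnisotropyChordTransferFibre3TwoHoleBSHankel
import Summits.HubbardSuperconductivity.HubbardSuperconductivity.Theorems.AnisotropyChordTransferFibre3ZSquareKernel

/-!
# Route `AnisotropyChord` / H0 rotor rung: ★ the NEAR-PAIR TAIL CERTIFICATE with the torus analysis DISCHARGED — HOLE₂(.75) for the pair `(z, z + d)` from the explicit ℤ² skeleton alone

Capstone of the `TwoHoleBS` (PROP BS) and `Subsample` (periodisation) chains (memo ROTOR-THEORY-21 §317(d), §320–§322).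
`…Fibre3TwoHoleBSTail.dualCert_threeQuarter_of_tail` certifies `DualCert L (¾ε₁) z₁ z₂` from a model kernel `A∞`, a shell bound
`Smax`, a periodisation bound `δper`, a capacity bound `Λup` and a margin inequality.  Here, for a pair at INTEGER OFFSET `d`
(`z₂ = z + d`), the model is FIXED to the ℤ² skeleton `skelA d (p,q) = 2·a_∞(ipt p − ipt q)` (`a_∞ = Subsample.aZ2`, the
modulus-independent limit kernel of `…Fibre3ChainLimit`) and BOTH analytic error inputs are discharged by tree theorems:
`Smax = ρmax(d)·(11.71 ln L + 5.9)/L²` (`RateLemma.shellMajorant_holds`) and `δper = 4C₀·ρmax(d)/L`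
(`Subsample.abs_aKer_sub_aZ2_le`), `ρmax(d) = (|d₁| + 2)² + (|d₂| + 2)²`, `C₀ = (15/2)(π²/2 + π⁴/4) + 3π²/16`:
* `clusterZ`, `ipt`, `castPt` (+ `castPt_add/sub`), `clusterPt_zero_eq_castPt`, `clusterZ_eq_add`, `bsPt_eq_castPt`,
  `bsPt_sub_eq_castPt` (the ten torus points of `(z, z + d)` are `z + castPt (ipt d p)`);
* `rhoMax`, `abs_clusterZ_zero_le`, `ipt_sub_bound`, `normSq_ipt_sub_le` (`|ipt p − ipt q|² ≤ ρmax(d)`);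
* `skelA`, `skelA_isSymm` (`aZ2_neg`);
* ★★★ `dualCert_threeQuarter_near`: for `8 ≤ L`, any `z`, any offset `d`, any `Λup ≥ 4H_{⌊L/2⌋}` with `Λup·s ≠ 1`: if `skelA d` is
  invertible and `ε(L,d)·(Σ_p |(E ŵ)_p|)² ≤ wᵀ·twoHoleP (skelA d) Λup·w` for all `w`, `E = smInv (skelA d) Λup`,
  `ε(L,d) = 2ρmax(11.71 ln L + 5.9)/L² + 4C₀ρmax/L → 0`, then `DualCert L (¾ε₁) z (z + d)` — every remaining hypothesis is about the
  explicit ℤ² skeleton (its entries are affine in the transcendental window values, `…Fibre3ZSquareKernel`) and the capacity parameter.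
Prover seat `hubbard-h0-rotor-p2` g2; helper for stmt-HubbardSuperconductivity-19089 (`--supports`, helper class).
WHAT THIS IS NOT: nothing here proves superconductivity in the Hubbard model; the rotor TARGET as originally worded stays
FALSE (g15 verdict).  HOLE₂(.75) for NEAR pairs and large `L` is reduced to numerics on an explicit ℤ² matrix; far pairs, the
skeleton margin itself and `9 ≤ L < L₀` remain (and with the crude constants here `L₀` is astronomically large).  Mathlib + tree
imports only; no sorry, no axioms.
-/

set_option linter.dupNamespace false

noncomputable section

open scoped BigOperators
open Complex Finset

namespace Summit.HubbardSuperconductivity.HubbardSuperconductivity.Theorems.AnisotropyChord.Transfer.Fibre3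

namespace TwoHoleBS

variable (L : ℕ) [NeZero L]

/-! ## Integer coordinates of the ten points -/

/-- integer coordinates of the one-hole cluster `{c, c + eₓ, c − eₓ, c + e_y, c − e_y}` (same order as `clusterPt`). [folklore] -/
def clusterZ (c : ℤ × ℤ) : Fin 5 → ℤ × ℤ := ![c, c + (1, 0), c + (-1, 0), c + (0, 1), c + (0, -1)]

/-- integer coordinates of the ten points of the pair `(0, d)` (same order as `bsPt`). [folklore] -/
def ipt (d : ℤ × ℤ) : Fin 5 ⊕ Fin 5 → ℤ × ℤ := Sum.elim (clusterZ 0) (clusterZ d)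

/-- the reduction `ℤ² → (ℤ/L)²`. [folklore] -/
def castPt (v : ℤ × ℤ) : Tor L := (((v.1 : ℤ) : ZMod L), ((v.2 : ℤ) : ZMod L))

omit [NeZero L] in
/-- `castPt` is additive. [folklore] -/
theorem castPt_add (v w : ℤ × ℤ) : castPt L (v + w) = castPt L v + castPt L w := by
  ext <;> simp [castPt]

omit [NeZero L] in
/-- `castPt` respects differences. [folklore] -/
theorem castPt_sub (v w : ℤ × ℤ) : castPt L (v - w) = castPt L v - castPt L w := by
  ext <;> simp [castPt]

omit [NeZero L] in
/-- the cluster at the origin in integer coordinates. [folklore] -/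
theorem clusterPt_zero_eq_castPt (i : Fin 5) : clusterPt L 0 i = castPt L (clusterZ 0 i) := by
  fin_cases i <;> simp [clusterPt, clusterZ, castPt, ex, ey, Prod.ext_iff]

/-- `clusterZ c i = c + clusterZ 0 i`. [folklore] -/
theorem clusterZ_eq_add (c : ℤ × ℤ) (i : Fin 5) : clusterZ c i = c + clusterZ 0 i := by
  fin_cases i <;> simp [clusterZ]

omit [NeZero L] in
/-- ★ the ten torus points of the pair `(z, z + d)` are `z + castPt (ipt d p)`. [folklore] -/
theorem bsPt_eq_castPt (z : Tor L) (d : ℤ × ℤ) (p : Fin 5 ⊕ Fin 5) :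
    bsPt L z (z + castPt L d) p = z + castPt L (ipt d p) := by
  rcases p with i | i
  · show clusterPt L z i = z + castPt L (clusterZ 0 i)
    rw [clusterPt_eq_add, clusterPt_zero_eq_castPt]
  · show clusterPt L (z + castPt L d) i = z + castPt L (clusterZ d i)
    rw [clusterPt_eq_add, clusterPt_zero_eq_castPt, clusterZ_eq_add d i, castPt_add, add_assoc]

omit [NeZero L] in
/-- differences of the ten points are casts of integer vectors. [folklore] -/
theorem bsPt_sub_eq_castPt (z : Tor L) (d : ℤ × ℤ) (p q : Fin 5 ⊕ Fin 5) :
    bsPt L z (z + castPt L d) p - bsPt L z (z + castPt L d) q = castPt L (ipt d p - ipt d q) := by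
  rw [bsPt_eq_castPt, bsPt_eq_castPt, castPt_sub, add_sub_add_left_eq_sub]

/-! ## Sizes of the difference vectors -/

/-- `ρmax(d) = (|d₁| + 2)² + (|d₂| + 2)²`, a bound for `|ipt p − ipt q|²`. [folklore] -/
def rhoMax (d : ℤ × ℤ) : ℝ := ((|d.1| : ℤ) + 2 : ℝ) ^ 2 + ((|d.2| : ℤ) + 2 : ℝ) ^ 2

/-- `0 ≤ ρmax`. [folklore] -/
theorem rhoMax_nonneg (d : ℤ × ℤ) : 0 ≤ rhoMax d := by unfold rhoMax; positivity

/-- the origin cluster has coordinates in `{−1, 0, 1}`. [folklore] -/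
theorem abs_clusterZ_zero_le (i : Fin 5) : |(clusterZ 0 i).1| ≤ 1 ∧ |(clusterZ 0 i).2| ≤ 1 := by
  fin_cases i <;> simp [clusterZ]

/-- coordinate bounds of the difference vectors: `|v₁| ≤ |d₁| + 2`, `|v₂| ≤ |d₂| + 2`. [folklore] -/
theorem ipt_sub_bound (d : ℤ × ℤ) (p q : Fin 5 ⊕ Fin 5) :
    |(ipt d p - ipt d q).1| ≤ |d.1| + 2 ∧ |(ipt d p - ipt d q).2| ≤ |d.2| + 2 := by
  have key : ∀ p : Fin 5 ⊕ Fin 5, ∃ c : ℤ × ℤ, (c = 0 ∨ c = d) ∧ |(ipt d p - c).1| ≤ 1 ∧ |(ipt d p - c).2| ≤ 1 := by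
    intro p
    rcases p with i | i
    · refine ⟨0, Or.inl rfl, ?_⟩
      show |(clusterZ 0 i - 0).1| ≤ 1 ∧ |(clusterZ 0 i - 0).2| ≤ 1
      rw [sub_zero]
      exact abs_clusterZ_zero_le i
    · refine ⟨d, Or.inr rfl, ?_⟩
      show |(clusterZ d i - d).1| ≤ 1 ∧ |(clusterZ d i - d).2| ≤ 1
      rw [clusterZ_eq_add, add_sub_cancel_left]
      exact abs_clusterZ_zero_le i
  obtain ⟨cp, hcp, hp1, hp2⟩ := key p
  obtain ⟨cq, hcq, hq1, hq2⟩ := key q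
  have hc : |(cp - cq).1| ≤ |d.1| ∧ |(cp - cq).2| ≤ |d.2| := by
    rcases hcp with rfl | rfl <;> rcases hcq with rfl | rfl <;> simp
  have e1 : (ipt d p - ipt d q).1 = ((ipt d p - cp).1 - (ipt d q - cq).1) + (cp - cq).1 := by
    simp only [Prod.fst_sub]; ring
  have e2 : (ipt d p - ipt d q).2 = ((ipt d p - cp).2 - (ipt d q - cq).2) + (cp - cq).2 := by
    simp only [Prod.snd_sub]; ring
  constructor
  · rw [e1]
    calc |((ipt d p - cp).1 - (ipt d q - cq).1) + (cp - cq).1|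
        ≤ |(ipt d p - cp).1 - (ipt d q - cq).1| + |(cp - cq).1| := abs_add_le _ _
      _ ≤ (|(ipt d p - cp).1| + |(ipt d q - cq).1|) + |(cp - cq).1| := add_le_add (abs_sub _ _) le_rfl
      _ ≤ (1 + 1) + |d.1| := add_le_add (add_le_add hp1 hq1) hc.1
      _ = |d.1| + 2 := by ring
  · rw [e2]
    calc |((ipt d p - cp).2 - (ipt d q - cq).2) + (cp - cq).2|
        ≤ |(ipt d p - cp).2 - (ipt d q - cq).2| + |(cp - cq).2| := abs_add_le _ _
      _ ≤ (|(ipt d p - cp).2| + |(ipt d q - cq).2|) + |(cp - cq).2| := add_le_add (abs_sub _ _) le_rfl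
      _ ≤ (1 + 1) + |d.2| := add_le_add (add_le_add hp2 hq2) hc.2
      _ = |d.2| + 2 := by ring

/-- ★ `|ipt p − ipt q|² ≤ ρmax(d)`. [folklore] -/
theorem normSq_ipt_sub_le (d : ℤ × ℤ) (p q : Fin 5 ⊕ Fin 5) :
    (((ipt d p - ipt d q).1 : ℤ) : ℝ) ^ 2 + (((ipt d p - ipt d q).2 : ℤ) : ℝ) ^ 2 ≤ rhoMax d := by
  obtain ⟨h1, h2⟩ := ipt_sub_bound d p q
  have h1' : |(((ipt d p - ipt d q).1 : ℤ) : ℝ)| ≤ ((|d.1| : ℤ) : ℝ) + 2 := by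
    rw [← Int.cast_abs]; exact_mod_cast h1
  have h2' : |(((ipt d p - ipt d q).2 : ℤ) : ℝ)| ≤ ((|d.2| : ℤ) : ℝ) + 2 := by
    rw [← Int.cast_abs]; exact_mod_cast h2
  have s1 := pow_le_pow_left₀ (abs_nonneg _) h1' 2
  have s2 := pow_le_pow_left₀ (abs_nonneg _) h2' 2
  rw [sq_abs] at s1 s2
  unfold rhoMax
  linarith

/-! ## The ℤ² skeleton kernel matrix of the pair -/

/-- ★ the skeleton kernel matrix `A∞(p,q) = 2·a_∞(ipt p − ipt q)` (walk units, cf. `kerMat`). [folklore] -/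
def skelA (d : ℤ × ℤ) : Matrix (Fin 5 ⊕ Fin 5) (Fin 5 ⊕ Fin 5) ℝ :=
  Matrix.of fun p q => 2 * Subsample.aZ2 (ipt d p - ipt d q).1 (ipt d p - ipt d q).2

/-- `A∞` is symmetric (`a_∞(−r) = a_∞(r)`). [folklore] -/
theorem skelA_isSymm (d : ℤ × ℤ) : (skelA d).IsSymm := by
  ext p q
  simp only [skelA, Matrix.transpose_apply, Matrix.of_apply]
  rw [← neg_sub (ipt d p) (ipt d q), Prod.fst_neg, Prod.snd_neg, Subsample.aZ2_neg]

/-! ## The near-pair tail certificate with discharged torus inputs -/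

/-- ★★★ **NEAR-PAIR TAIL CERTIFICATE** (HOLE₂(.75) point `g = ¾ε₁`, pair `(z, z + d)`, `8 ≤ L`): the torus-analysis hypotheses
of `dualCert_threeQuarter_of_tail` are discharged with `A∞ = skelA d`, `Smax = ρmax(11.71 ln L + 5.9)/L²`
(`RateLemma.shellMajorant_holds`) and `δper = 4C₀ρmax/L` (`Subsample.abs_aKer_sub_aZ2_le`); what remains is invertibility of the
explicit ℤ² skeleton, the capacity parameter `Λup ≥ 4H_{⌊L/2⌋}` with `Λup·s ≠ 1`, and the margin inequality with the vanishing error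
coefficient `ε(L,d) = 2ρmax(11.71 ln L + 5.9)/L² + 4C₀ρmax/L`. [folklore] -/
theorem dualCert_threeQuarter_near (hL : 8 ≤ L) (z : Tor L) (d : ℤ × ℤ) (Λup : ℝ)
    (hA : IsUnit (skelA d).det)
    (hcap : 4 * (harmonic (L / 2) : ℝ) ≤ Λup) (hΛ : Λup * TwoChannel.svec2 (skelA d) - 1 ≠ 0)
    (hpos : ∀ w : Fin 4 ⊕ Fin 4 → ℝ,
      (2 * (rhoMax d * (11.71 * Real.log L + 5.9) / (L : ℝ) ^ 2)
          + 4 * (((15 / 2 * (Real.pi ^ 2 / 2 + Real.pi ^ 4 / 4) + 3 * Real.pi ^ 2 / 16)) * rhoMax d) / L)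
        * (∑ p : Fin 5 ⊕ Fin 5, |(smInv (skelA d) Λup).mulVec (pad w) p|) ^ 2
        ≤ dotProduct w ((TwoChannel.twoHoleP (skelA d) Λup).mulVec w)) :
    DualCert L (3 / 4 * eps1 L) z (z + castPt L d) := by
  have hL1 : (1 : ℝ) ≤ L := by exact_mod_cast (show 1 ≤ L by omega)
  have hLpos : (0 : ℝ) < L := by linarith
  have he := RateLemma.eps1_pos_of_two_le L (by omega)
  have hlog : 0 ≤ 11.71 * Real.log L + 5.9 := by
    have := Real.log_nonneg hL1
    positivity
  refine dualCert_threeQuarter_of_tail L hL z (z + castPt L d) (skelA d) (skelA_isSymm d) hA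
    (rhoMax d * (11.71 * Real.log L + 5.9) / (L : ℝ) ^ 2)
    (4 * (((15 / 2 * (Real.pi ^ 2 / 2 + Real.pi ^ 4 / 4) + 3 * Real.pi ^ 2 / 16)) * rhoMax d) / L) Λup
    (fun p q => ?_) (fun p q => ?_) hcap hΛ hpos
  · -- the shell bound, `shellMajorant_holds` at `λ = 2g = (3/2)ε₁`
    rw [bsPt_sub_eq_castPt]
    unfold castPt
    have h := RateLemma.shellMajorant_holds L hL (2 * (3 / 4 * eps1 L)) (by positivity) (by linarith)
      (ipt d p - ipt d q).1 (ipt d p - ipt d q).2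
    refine h.trans ?_
    rw [mul_div_assoc, mul_div_assoc]
    exact mul_le_mul_of_nonneg_right (normSq_ipt_sub_le d p q) (by positivity)
  · -- the periodisation bound, `abs_aKer_sub_aZ2_le`
    rw [bsPt_sub_eq_castPt]
    simp only [skelA, Matrix.of_apply]
    unfold castPt
    have h := Subsample.abs_aKer_sub_aZ2_le L (ipt d p - ipt d q).1 (ipt d p - ipt d q).2
    have hC : (0 : ℝ) ≤ (15 / 2 * (Real.pi ^ 2 / 2 + Real.pi ^ 4 / 4) + 3 * Real.pi ^ 2 / 16) := by positivity
    rw [← mul_sub, abs_mul, abs_two]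
    have hρ := normSq_ipt_sub_le d p q
    calc 2 * |aKer L 0 ((((ipt d p - ipt d q).1 : ℤ) : ZMod L), (((ipt d p - ipt d q).2 : ℤ) : ZMod L))
          - Subsample.aZ2 (ipt d p - ipt d q).1 (ipt d p - ipt d q).2|
        ≤ 2 * (2 * ((15 / 2 * (Real.pi ^ 2 / 2 + Real.pi ^ 4 / 4) + 3 * Real.pi ^ 2 / 16)
            * ((((ipt d p - ipt d q).1 : ℤ) : ℝ) ^ 2 + (((ipt d p - ipt d q).2 : ℤ) : ℝ) ^ 2)) / L) := by gcongr
      _ ≤ 2 * (2 * ((15 / 2 * (Real.pi ^ 2 / 2 + Real.pi ^ 4 / 4) + 3 * Real.pi ^ 2 / 16) * rhoMax d) / L) := by gcongr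
      _ = _ := by ring

end TwoHoleBS

end Summit.HubbardSuperconductivity.HubbardSuperconductivity.Theorems.AnisotropyChord.Transfer.Fibre3

end
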